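import Literature.Geometry.DiscreteGeometry.KissingAngleBounds
import HarnessLib

/-!
# Kertész 1994 — local rigidity of the northern triangle at colatitude `arcsin (1/√3)`

Topic `Literature/Geometry/DiscreteGeometry`; third provefact instalment for the named fact
`kertesz1994_ninePointsHemisphere` (`KerteszNinePointsHemisphere.lean`), after
`KerteszNorthernPoints.lean` (azimuth bounds, latitude `> 45°`) and `KerteszLiftPenalty.lean` (raised
low points never buy azimuth).  Notation as there: a northern point of height `w = ⟪e, h⟫` has
horizontal radius `r = √(1 − w²)`; the azimuth about the pole between a northern point and an
equatorial low point at inner product `≤ 1/2` is `≥ D(w) := arccos (1/(2r))`, between two northern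
points `≥ A(w, w') := arccos ((1/2 − w w')/(r r'))`.  At Kertész's configuration all three northern
heights are `w* = √(2/3) = √6/3`, `D(w*) = π/6`, `A(w*, w*) = 2π/3`, and the azimuth budget
`2π = Σ (sector)` is attained by every one of the eight "jump/walk" covers of the three sectors.

This file PROVES that the budget is RIGID there (no definitions, no named facts, no calculus — cosine
comparisons and one exact identity):

* `arccos_highHigh_ge_local` — **(★)** on the cube `0.8138 ≤ w, w' ≤ 0.8192`:
  `A(w, w') ≥ π − D(w) − D(w') − 20 (w − w')²`.  Behind it the identity
  `4 r r' (cos A + cos (D + D')) = Q − P`, `Q = 3 − 4ww'`, `P = 4 r r' sin D sin D'`,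
  `Q² − P² = 12 (w − w')²` (so `A(w, w) = π − 2 D(w)` exactly);
* `three_mul_le_pi_div_six_sub_arccos`, `pi_div_six_sub_arccos_le_three_mul` — the slope of
  `u(w) := π/6 − D(w)` at `w*`: `u(w) ≥ 3 (w − w*)` for `w ≥ w*` and `u(w) ≤ 3 (w − w*)` for
  `w ≤ w*` on the cube (the true slope is `3√2 = 4.24…`);
* `local_budget_algebra` — the bookkeeping: if `bₖ ≥ yₖ − 20 dₖ²`, `|uⱼ| ≥ 3 |tⱼ|`, `|tⱼ| ≤ 3/1000`
  and the eight cover inequalities `Σ_{k ∈ S} bₖ + Σ_{k ∉ S} (pₖ − yₖ) ≤ 0` hold with `pₖ ≥ 0`,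
  then `t = 0` and `p = 0`;
* **`kertesz_local_rigidity`** — for northern heights in the cube and non-negative sector penalties
  `p₁₂, p₂₃, p₃₁`, the eight cover inequalities
  `Σ_{k ∈ S} A_k + Σ_{k ∉ S} (D_j + D_k + π/3 + p_k) ≤ 2π` force `p₁₂ = p₂₃ = p₃₁ = 0` and
  `w₁ = w₂ = w₃ = √6/3`.

With the certified budget (cell record HOME/cf-lit/kertesz/BLUEPRINT.md §4: outside this cube the
`z = 0` budget exceeds `2π`) and `sector_lift_penalty` (`pₖ ≥ (z + z')/4`), this is the last analytic
step of the discharge: the low points are equatorial.  WHAT THIS IS NOT: the discharge itself — the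
cover machinery and the kernel port of the two branch-and-bounds remain.

## References
* G. Kertész, *Nine points on the hemisphere*, Colloq. Math. Soc. János Bolyai 63 (1994) 189–196;
  Zbl 0822.52005 ("until at the end the latitudes, and relative longitudes, are completely
  determined"). [`Kertesz1994`]
-/

noncomputable section

namespace Literature.Geometry.DiscreteGeometry

open Real

/-! ### Elementary helpers -/

/-- `y − y³/6 ≤ sin y` for `y ≥ 0`. [folklore] -/
private theorem sub_cube_le_sin {y : ℝ} (hy : 0 ≤ y) : y - y ^ 3 / 6 ≤ sin y := by
  rcases hy.eq_or_lt with h | h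
  · rw [← h]; simp
  · exact (Real.sin_gt_sub_cube h).le

/-- On the cube: `0.3289 ≤ 1 − w² ≤ 0.3378`. [folklore] -/
private theorem one_sub_sq_bounds {w : ℝ} (h0 : 0.8138 ≤ w) (h1 : w ≤ 0.8192) :
    0.3289 ≤ 1 - w ^ 2 ∧ 1 - w ^ 2 ≤ 0.3378 := by
  constructor <;> nlinarith

/-- `√6/3 ∈ (0.81649, 0.8165)`. [folklore] -/
private theorem sqrt_six_div_three_bounds : (0.81649 : ℝ) < √6 / 3 ∧ √6 / 3 < 0.8165 := by
  constructor
  · have : (2.44947 : ℝ) < √6 := by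
      rw [Real.lt_sqrt (by norm_num)]; norm_num
    linarith
  · have : √6 < (2.4495 : ℝ) := by
      rw [Real.sqrt_lt' (by norm_num)]; norm_num
    linarith

/-- From `a² ≤ b²`, `0 ≤ b`: `a ≤ b`; from `b² ≤ a²`, `0 ≤ a`... as needed: `0 ≤ a`, `c² ≤ a²`,
`0 ≤ c` give `c ≤ a`. [folklore] -/
private theorem le_of_sq_le_sq_nonneg {a c : ℝ} (ha : 0 ≤ a) (h : c ^ 2 ≤ a ^ 2) : c ≤ a := by
  by_contra hlt
  have hlt : a < c := lt_of_not_ge hlt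
  nlinarith [mul_pos (by linarith : 0 < c - a) (by linarith : 0 < c + a)]

/-- `x₀ = 1/(2r)` on the cube: `0.86 ≤ x₀ ≤ 0.872`, and `√(1 − x₀²) ∈ [0.489, 0.511]`. [folklore] -/
private theorem x0_bounds {r x₀ : ℝ} (hr0 : 0 < r) (hr2lo : 0.3289 ≤ r ^ 2) (hr2hi : r ^ 2 ≤ 0.3378)
    (hx : x₀ * (2 * r) = 1) : 0.86 ≤ x₀ ∧ x₀ ≤ 0.872 := by
  have hx0 : 0 < x₀ := by
    by_contra h
    have : x₀ * (2 * r) ≤ 0 := mul_nonpos_of_nonpos_of_nonneg (not_lt.1 h) (by linarith)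
    linarith
  have hsq : x₀ ^ 2 * (4 * r ^ 2) = 1 := by
    have : (x₀ * (2 * r)) ^ 2 = 1 := by rw [hx]; norm_num
    nlinarith [this]
  constructor
  · by_contra h
    have h' : x₀ < 0.86 := lt_of_not_ge h
    have : x₀ ^ 2 < 0.86 ^ 2 := by nlinarith
    nlinarith
  · by_contra h
    have h' : 0.872 < x₀ := lt_of_not_ge h
    have : 0.872 ^ 2 < x₀ ^ 2 := by nlinarith
    nlinarith

/-- `sD = √(1 − x₀²)` on the cube lies in `[0.489, 0.511]`. [folklore] -/
private theorem sD_bounds {x₀ : ℝ} (hlo : 0.86 ≤ x₀) (hhi : x₀ ≤ 0.872) :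
    0.489 ≤ √(1 - x₀ ^ 2) ∧ √(1 - x₀ ^ 2) ≤ 0.511 := by
  constructor
  · exact Real.le_sqrt_of_sq_le (by nlinarith)
  · rw [show (0.511 : ℝ) = √(0.511 ^ 2) from (Real.sqrt_sq (by norm_num)).symm]
    exact Real.sqrt_le_sqrt (by nlinarith)

/-- `(x − y)² ≤ 2x² + 2y²`. [folklore] -/
private theorem sq_sub_le_two (x y : ℝ) : (x - y) ^ 2 ≤ 2 * x ^ 2 + 2 * y ^ 2 := by
  nlinarith [sq_nonneg (x + y)]

/-- `(20 d²)³ ≤ 0.001 d²` for `d² ≤ 0.00003`. [folklore] -/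
private theorem cube_small {d : ℝ} (h : d ^ 2 ≤ 0.00003) : (20 * d ^ 2) ^ 3 ≤ 0.001 * d ^ 2 := by
  have h0 : 0 ≤ d ^ 2 := sq_nonneg d
  have h1 : (d ^ 2) ^ 2 ≤ 0.00003 * d ^ 2 := by nlinarith
  have h2 : (d ^ 2) ^ 2 * d ^ 2 ≤ 0.00003 * d ^ 2 * d ^ 2 := mul_le_mul_of_nonneg_right h1 h0
  have : (20 * d ^ 2) ^ 3 = 8000 * ((d ^ 2) ^ 2 * d ^ 2) := by ring
  rw [this]
  nlinarith

/-- The algebra of (★) over abstract reals: with `r² = 1 − w²`, `x₀ (2r) = 1`, `sD² = 1 − x₀²`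
(and primed), `(1/2 − ww')/(r r') + (x₀ x₀' − sD sD') ≤ 14.6 (w − w')²` on the cube. [folklore] -/
private theorem eta_bound {w w' r r' x₀ x₀' sD sD' : ℝ} (hw0 : 0.8138 ≤ w) (hw1 : w ≤ 0.8192)
    (hw0' : 0.8138 ≤ w') (hw1' : w' ≤ 0.8192) (hr2 : r ^ 2 = 1 - w ^ 2) (hr'2 : r' ^ 2 = 1 - w' ^ 2)
    (hrpos : 0 < r) (hr'pos : 0 < r') (hx₀r : x₀ * (2 * r) = 1) (hx₀'r : x₀' * (2 * r') = 1)
    (hsD2 : sD ^ 2 = 1 - x₀ ^ 2) (hsD'2 : sD' ^ 2 = 1 - x₀' ^ 2) (hsD0 : 0 ≤ sD) (hsD'0 : 0 ≤ sD') :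
    (1 / 2 - w * w') / (r * r') + (x₀ * x₀' - sD * sD') ≤ 14.6 * (w - w') ^ 2 := by
  obtain ⟨hr2lo, hr2hi⟩ := one_sub_sq_bounds hw0 hw1
  obtain ⟨hr2lo', hr2hi'⟩ := one_sub_sq_bounds hw0' hw1'
  have hx₀sq : x₀ ^ 2 * (4 * (1 - w ^ 2)) = 1 := by
    calc x₀ ^ 2 * (4 * (1 - w ^ 2)) = (x₀ * (2 * r)) ^ 2 := by rw [← hr2]; ring
      _ = 1 := by rw [hx₀r]; norm_num
  have hx₀'sq : x₀' ^ 2 * (4 * (1 - w' ^ 2)) = 1 := by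
    calc x₀' ^ 2 * (4 * (1 - w' ^ 2)) = (x₀' * (2 * r')) ^ 2 := by rw [← hr'2]; ring
      _ = 1 := by rw [hx₀'r]; norm_num
  set c := (1 / 2 - w * w') / (r * r') with hcdef
  set Q := 3 - 4 * w * w' with hQdef
  set P := 4 * (r * r') * (sD * sD') with hPdef
  set d := w - w' with hddef
  have hP0 : 0 ≤ P := by rw [hPdef]; positivity
  have hcr : c * (r * r') = 1 / 2 - w * w' := by rw [hcdef]; field_simp
  have hxx : 4 * (r * r') * (x₀ * x₀') = 1 := by
    calc 4 * (r * r') * (x₀ * x₀') = (x₀ * (2 * r)) * (x₀' * (2 * r')) := by ring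
      _ = 1 := by rw [hx₀r, hx₀'r]; norm_num
  have hkey : 4 * (r * r') * (c + (x₀ * x₀' - sD * sD')) = Q - P := by
    rw [hQdef, hPdef]
    linear_combination 4 * hcr + hxx
  have hP2 : P ^ 2 = (3 - 4 * w ^ 2) * (3 - 4 * w' ^ 2) := by
    have h1 : (2 * r * sD) ^ 2 = 3 - 4 * w ^ 2 := by
      have : (2 * r * sD) ^ 2 = 4 * r ^ 2 * sD ^ 2 := by ring
      rw [this, hsD2, hr2]
      linear_combination (-1 : ℝ) * hx₀sq
    have h2 : (2 * r' * sD') ^ 2 = 3 - 4 * w' ^ 2 := by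
      have : (2 * r' * sD') ^ 2 = 4 * r' ^ 2 * sD' ^ 2 := by ring
      rw [this, hsD'2, hr'2]
      linear_combination (-1 : ℝ) * hx₀'sq
    have : P = (2 * r * sD) * (2 * r' * sD') := by rw [hPdef]; ring
    rw [this, mul_pow, h1, h2]
  have hQP : (Q - P) * (Q + P) = 12 * d ^ 2 := by
    have : (Q - P) * (Q + P) = Q ^ 2 - P ^ 2 := by ring
    rw [this, hP2, hQdef, hddef]; ring
  have hPlo : 0.3156 ≤ P := by
    have h1 : 0.3156 ≤ 3 - 4 * w ^ 2 := by nlinarith only [hw0, hw1]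
    have h2 : 0.3156 ≤ 3 - 4 * w' ^ 2 := by nlinarith only [hw0', hw1']
    have h3 : (0.3156 : ℝ) ^ 2 ≤ P ^ 2 := by
      rw [hP2, sq]; exact mul_le_mul h1 h2 (by norm_num) (by linarith)
    exact le_of_sq_le_sq_nonneg hP0 h3
  have hQlo : 0.3156 ≤ Q := by
    rw [hQdef]
    nlinarith only [hw0, hw1, hw0', hw1', mul_le_mul hw1 hw1' (by linarith) (by linarith)]
  have hQPlo : 0.6312 ≤ Q + P := by linarith
  have hQmP : Q - P ≤ 19.1 * d ^ 2 := by
    have h1 : Q - P = 12 * d ^ 2 / (Q + P) := by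
      rw [eq_div_iff (by linarith)]; exact hQP
    rw [h1, div_le_iff₀ (by linarith)]
    have h2 := mul_le_mul_of_nonneg_left hQPlo (show (0 : ℝ) ≤ 19.1 * d ^ 2 by positivity)
    linarith only [sq_nonneg d, h2]
  have hrr : 0.3289 ≤ r * r' := by
    have h1 : (0.3289 : ℝ) ^ 2 ≤ (r * r') ^ 2 := by
      rw [mul_pow, hr2, hr'2, sq]; exact mul_le_mul hr2lo hr2lo' (by norm_num) (by linarith)
    exact le_of_sq_le_sq_nonneg (by positivity) h1
  have h1 : (c + (x₀ * x₀' - sD * sD')) * (4 * (r * r')) ≤ 14.6 * d ^ 2 * (4 * (r * r')) := by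
    have h2 : (c + (x₀ * x₀' - sD * sD')) * (4 * (r * r')) = Q - P := by rw [← hkey]; ring
    rw [h2]
    have h3 := mul_le_mul_of_nonneg_left hrr (show (0 : ℝ) ≤ 14.6 * d ^ 2 * 4 by positivity)
    linarith only [h3, hQmP, sq_nonneg d]
  exact le_of_mul_le_mul_right h1 (by positivity)

/-- The cosine comparison of (★) over abstract reals: from `c + C₀ ≤ 14.6 e`, `C₀ ≥ 0`,
`S₀ ≥ 0.84`, `0 ≤ e ≤ 0.00003`: `c ≤ −(C₀ cos (20e) − S₀ sin (20e))`. [folklore] -/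
private theorem cos_step {c C₀ S₀ e : ℝ} (hη : c + C₀ ≤ 14.6 * e) (hC0 : 0 ≤ C₀) (hS0 : 0.84 ≤ S₀)
    (he0 : 0 ≤ e) (he : e ≤ 0.00003) : c ≤ -(C₀ * cos (20 * e) - S₀ * sin (20 * e)) := by
  have hy0 : 0 ≤ 20 * e := by positivity
  have hsin : 20 * e - (20 * e) ^ 3 / 6 ≤ sin (20 * e) := sub_cube_le_sin hy0
  have hd6 : (20 * e) ^ 3 ≤ 0.001 * e := by
    have h1 : e ^ 2 ≤ 0.00003 * e := by nlinarith
    have h2 : e ^ 2 * e ≤ 0.00003 * e * e := mul_le_mul_of_nonneg_right h1 he0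
    have : (20 * e) ^ 3 = 8000 * (e ^ 2 * e) := by ring
    rw [this]
    nlinarith
  have hsin0 : 0 ≤ sin (20 * e) := le_trans (by linarith only [hd6, he0]) hsin
  have h1 : C₀ * cos (20 * e) ≤ C₀ := mul_le_of_le_one_right hC0 (Real.cos_le_one _)
  have h2 : 0.84 * sin (20 * e) ≤ S₀ * sin (20 * e) := mul_le_mul_of_nonneg_right hS0 hsin0
  have h3 : 0.84 * (20 * e - (20 * e) ^ 3 / 6) ≤ 0.84 * sin (20 * e) :=
    mul_le_mul_of_nonneg_left hsin (by norm_num)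
  linarith only [hη, h1, h2, h3, hd6, he0]

/-! ### (★) The near-diagonal lower bound for the high–high azimuth -/

/-- **Near-diagonal lower bound for the high–high azimuth (★).**  For `0.8138 ≤ w, w' ≤ 0.8192`,
`arccos ((1/2 − ww')/(r r')) ≥ π − arccos (1/(2r)) − arccos (1/(2r')) − 20 (w − w')²`
(`r = √(1 − w²)`, `r' = √(1 − w'²)`).  Proof: with `x₀ = 1/(2r) = cos D`, `sin D = √(1 − x₀²)`,
`4 r r' (cos A + cos (D + D')) = Q − P` where `Q = 3 − 4ww'`, `P = 4 r r' sin D sin D' ≥ 0`,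
`Q² − P² = 12 (w − w')²`, `Q + P ≥ 0.63`; hence `cos A ≤ −cos (D + D') + 14.6 (w − w')² ≤
−cos (D + D' + 20 (w − w')²)` (`sin (D + D') ≥ 0.84`), and `arccos` is antitone.
[cite: Kertesz1994, proof ("the latitudes, and relative longitudes, are completely determined")] -/
theorem arccos_highHigh_ge_local {w w' : ℝ} (hw0 : 0.8138 ≤ w) (hw1 : w ≤ 0.8192)
    (hw0' : 0.8138 ≤ w') (hw1' : w' ≤ 0.8192) :
    π - arccos (1 / (2 * √(1 - w ^ 2))) - arccos (1 / (2 * √(1 - w' ^ 2))) - 20 * (w - w') ^ 2 ≤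
      arccos ((1 / 2 - w * w') / (√(1 - w ^ 2) * √(1 - w' ^ 2))) := by
  obtain ⟨hr2lo, hr2hi⟩ := one_sub_sq_bounds hw0 hw1
  obtain ⟨hr2lo', hr2hi'⟩ := one_sub_sq_bounds hw0' hw1'
  set r := √(1 - w ^ 2) with hrdef
  set r' := √(1 - w' ^ 2) with hr'def
  have hr2 : r ^ 2 = 1 - w ^ 2 := by rw [hrdef, Real.sq_sqrt (by linarith)]
  have hr'2 : r' ^ 2 = 1 - w' ^ 2 := by rw [hr'def, Real.sq_sqrt (by linarith)]
  have hr0 : 0 ≤ r := Real.sqrt_nonneg _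
  have hr'0 : 0 ≤ r' := Real.sqrt_nonneg _
  have hrpos : 0 < r := by
    rcases hr0.eq_or_lt with h | h
    · rw [← h] at hr2; linarith
    · exact h
  have hr'pos : 0 < r' := by
    rcases hr'0.eq_or_lt with h | h
    · rw [← h] at hr'2; linarith
    · exact h
  -- `x₀ = cos D`, `sD = sin D`
  set x₀ : ℝ := 1 / (2 * r) with hx₀def
  set x₀' : ℝ := 1 / (2 * r') with hx₀'def
  have hx₀r : x₀ * (2 * r) = 1 := by rw [hx₀def]; field_simp
  have hx₀'r : x₀' * (2 * r') = 1 := by rw [hx₀'def]; field_simp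
  obtain ⟨hx₀lo, hx₀hi⟩ := x0_bounds hrpos (by rw [hr2]; exact hr2lo) (by rw [hr2]; exact hr2hi) hx₀r
  obtain ⟨hx₀'lo, hx₀'hi⟩ :=
    x0_bounds hr'pos (by rw [hr'2]; exact hr2lo') (by rw [hr'2]; exact hr2hi') hx₀'r
  have hx₀1 : x₀ ≤ 1 := by linarith
  have hx₀'1 : x₀' ≤ 1 := by linarith
  set D := arccos x₀ with hDdef
  set D' := arccos x₀' with hD'def
  have hcosD : cos D = x₀ := by rw [hDdef, Real.cos_arccos (by linarith) hx₀1]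
  have hcosD' : cos D' = x₀' := by rw [hD'def, Real.cos_arccos (by linarith) hx₀'1]
  set sD := √(1 - x₀ ^ 2) with hsDdef
  set sD' := √(1 - x₀' ^ 2) with hsD'def
  have hsinD : sin D = sD := by rw [hDdef, Real.sin_arccos]
  have hsinD' : sin D' = sD' := by rw [hD'def, Real.sin_arccos]
  have hsD2 : sD ^ 2 = 1 - x₀ ^ 2 := by
    rw [hsDdef, Real.sq_sqrt (by nlinarith only [hx₀lo, hx₀hi])]
  have hsD'2 : sD' ^ 2 = 1 - x₀' ^ 2 := by
    rw [hsD'def, Real.sq_sqrt (by nlinarith only [hx₀'lo, hx₀'hi])]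
  have hsD0 : 0 ≤ sD := Real.sqrt_nonneg _
  have hsD'0 : 0 ≤ sD' := Real.sqrt_nonneg _
  obtain ⟨hsDlo, hsDhi⟩ := sD_bounds hx₀lo hx₀hi
  obtain ⟨hsD'lo, hsD'hi⟩ := sD_bounds hx₀'lo hx₀'hi
  rw [← hsDdef] at hsDlo hsDhi
  rw [← hsD'def] at hsD'lo hsD'hi
  -- `D, D' ≤ π/3`, so the target angle `π − X` lies in `[0, π]`
  have hDlt : D ≤ π / 3 := by
    rw [hDdef, ← Real.arccos_cos (x := π / 3) (by positivity) (by linarith [Real.pi_pos]),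
      Real.cos_pi_div_three]
    exact Real.arccos_le_arccos (by linarith)
  have hD'lt : D' ≤ π / 3 := by
    rw [hD'def, ← Real.arccos_cos (x := π / 3) (by positivity) (by linarith [Real.pi_pos]),
      Real.cos_pi_div_three]
    exact Real.arccos_le_arccos (by linarith)
  have hD0 : 0 ≤ D := Real.arccos_nonneg _
  have hD'0 : 0 ≤ D' := Real.arccos_nonneg _
  set d := w - w' with hddef
  have hd2 : d ^ 2 ≤ 0.00003 := by
    have h1 : 0 ≤ (0.0054 - d) * (d + 0.0054) :=
      mul_nonneg (by rw [hddef]; linarith) (by rw [hddef]; linarith)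
    have h2 : (0.0054 - d) * (d + 0.0054) = 0.0054 ^ 2 - d ^ 2 := by ring
    rw [h2] at h1
    norm_num at h1
    linarith
  set X := D + D' + 20 * d ^ 2 with hXdef
  have hX0 : 0 ≤ π - X := by
    rw [hXdef]; linarith only [Real.pi_gt_three, hd2, hDlt, hD'lt]
  have hXπ : π - X ≤ π := by
    rw [hXdef]; linarith only [hD0, hD'0, sq_nonneg d]
  -- (★): `c + cos (D + D') ≤ 14.6 d²`, then the cosine comparison
  set c := (1 / 2 - w * w') / (r * r') with hcdef
  have hC0 : cos (D + D') = x₀ * x₀' - sD * sD' := by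
    rw [Real.cos_add, hcosD, hcosD', hsinD, hsinD']
  have hS0 : sin (D + D') = sD * x₀' + x₀ * sD' := by
    rw [Real.sin_add, hcosD, hcosD', hsinD, hsinD']
  have hη : c + cos (D + D') ≤ 14.6 * d ^ 2 := by
    rw [hC0, hcdef, hddef]
    exact eta_bound hw0 hw1 hw0' hw1' hr2 hr'2 hrpos hr'pos hx₀r hx₀'r hsD2 hsD'2 hsD0 hsD'0
  have hC0pos : 0 ≤ cos (D + D') := by
    rw [hC0]
    have h1 := mul_le_mul hx₀lo hx₀'lo (by norm_num) (by linarith)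
    have h2 := mul_le_mul hsDhi hsD'hi hsD'0 (by norm_num)
    linarith
  have hS0lo : 0.84 ≤ sin (D + D') := by
    rw [hS0]
    have h1 := mul_le_mul hsDlo hx₀'lo (by norm_num) hsD0
    have h2 := mul_le_mul hx₀lo hsD'lo (by norm_num) (by linarith)
    linarith
  have hcosX : c ≤ cos (π - X) := by
    rw [Real.cos_pi_sub, hXdef, Real.cos_add (D + D')]
    exact cos_step hη hC0pos hS0lo (sq_nonneg d) hd2
  -- conclude with the antitone `arccos`
  calc π - D - D' - 20 * d ^ 2 = π - X := by rw [hXdef]; ring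
    _ = arccos (cos (π - X)) := by rw [Real.arccos_cos hX0 hXπ]
    _ ≤ arccos c := Real.arccos_le_arccos hcosX

/-! ### The slope of `u(w) = π/6 − D(w)` at `w* = √6/3` -/

/-- The polynomial behind the slope from above: with `a = √3 < b = √6`, `t ≥ 0`,
`(1 − (b/3 + t)²)(a + 3t)² ≤ 1` (the difference is `(2b − 2a) t + 4ab t² + 6(a + b) t³ + 9t⁴`).
[folklore] -/
private theorem slope_upper_poly {a b t : ℝ} (ha2 : a ^ 2 = 3) (hb2 : b ^ 2 = 6) (ha0 : 0 ≤ a)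
    (hab : a ≤ b) (ht0 : 0 ≤ t) : (1 - (b / 3 + t) ^ 2) * (a + 3 * t) ^ 2 ≤ 1 := by
  have key : 1 - (1 - (b / 3 + t) ^ 2) * (a + 3 * t) ^ 2 =
      (1 - (1 - b ^ 2 / 9) * a ^ 2) + (-6 * (1 - b ^ 2 / 9) * a + (2 * b / 3) * a ^ 2) * t
      + (-9 * (1 - b ^ 2 / 9) + 6 * a * (2 * b / 3) + a ^ 2) * t ^ 2 + (9 * (2 * b / 3) + 6 * a) * t ^ 3
      + 9 * t ^ 4 := by
    ring
  have hc0 : 1 - (1 - b ^ 2 / 9) * a ^ 2 = 0 := by rw [hb2, ha2]; norm_num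
  have hc1 : -6 * (1 - b ^ 2 / 9) * a + (2 * b / 3) * a ^ 2 = 2 * b - 2 * a := by
    rw [ha2, hb2]; ring
  have hc2 : -9 * (1 - b ^ 2 / 9) + 6 * a * (2 * b / 3) + a ^ 2 = 4 * a * b := by
    rw [ha2, hb2]; ring
  rw [hc0, hc1, hc2] at key
  have hb0 : 0 ≤ b := ha0.trans hab
  have h1 : 0 ≤ (2 * b - 2 * a) * t := mul_nonneg (by linarith) ht0
  have h2 : 0 ≤ 4 * a * b * t ^ 2 := by positivity
  have h3 : 0 ≤ (9 * (2 * b / 3) + 6 * a) * t ^ 3 := by positivity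
  have h4 : 0 ≤ 9 * t ^ 4 := by positivity
  linarith

/-- **Slope from above**: for `√6/3 ≤ w ≤ 0.8192`, `π/6 − arccos (1/(2 √(1 − w²))) ≥ 3 (w − √6/3)`.
(`cos (π/6 − 3t) ≤ √3/2 + 3t/2 ≤ 1/(2r)` by `slope_upper_poly`, `t = w − √6/3`.)
[cite: Kertesz1994, proof (range-narrowing, final step)] -/
theorem three_mul_le_pi_div_six_sub_arccos {w : ℝ} (hw0 : √6 / 3 ≤ w) (hw1 : w ≤ 0.8192) :
    3 * (w - √6 / 3) ≤ π / 6 - arccos (1 / (2 * √(1 - w ^ 2))) := by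
  obtain ⟨hs6lo, hs6hi⟩ := sqrt_six_div_three_bounds
  have hw0' : 0.8138 ≤ w := by linarith
  obtain ⟨hr2lo, hr2hi⟩ := one_sub_sq_bounds hw0' hw1
  set r := √(1 - w ^ 2) with hrdef
  have hr2 : r ^ 2 = 1 - w ^ 2 := by rw [hrdef, Real.sq_sqrt (by linarith)]
  have hr0 : 0 ≤ r := Real.sqrt_nonneg _
  have hrpos : 0 < r := by
    rcases hr0.eq_or_lt with h | h
    · rw [← h] at hr2; linarith
    · exact h
  set a := √3 with hadef
  set b := √6 with hbdef
  have ha2 : a ^ 2 = 3 := Real.sq_sqrt (by norm_num)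
  have hb2 : b ^ 2 = 6 := Real.sq_sqrt (by norm_num)
  have ha0 : 0 ≤ a := Real.sqrt_nonneg _
  have hab : a ≤ b := Real.sqrt_le_sqrt (by norm_num)
  set t := w - b / 3 with htdef
  have ht0 : 0 ≤ t := by rw [htdef]; linarith
  have ht1 : t ≤ 0.003 := by rw [htdef]; linarith
  set θ := π / 6 - 3 * t with hθdef
  have hθ0 : 0 ≤ θ := by rw [hθdef]; linarith [Real.pi_gt_three]
  have hθπ : θ ≤ π := by rw [hθdef]; linarith [Real.pi_gt_three]
  -- `cos θ ≤ a/2 + 3t/2`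
  have hcosθ : cos θ ≤ a / 2 + 3 * t / 2 := by
    rw [hθdef, Real.cos_sub, Real.cos_pi_div_six, Real.sin_pi_div_six, ← hadef]
    have h1 : cos (3 * t) ≤ 1 := Real.cos_le_one _
    have h2 : sin (3 * t) ≤ 3 * t := Real.sin_le (by linarith)
    have h3 : a / 2 * cos (3 * t) ≤ a / 2 := mul_le_of_le_one_right (by positivity) h1
    linarith
  -- `a/2 + 3t/2 ≤ 1/(2r)` from `r² (a + 3t)² ≤ 1`
  have hw : w = b / 3 + t := by rw [htdef]; ring
  have hpoly : (r * (a + 3 * t)) ^ 2 ≤ 1 := by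
    rw [mul_pow, hr2, hw]; exact slope_upper_poly ha2 hb2 ha0 hab ht0
  have hx : a / 2 + 3 * t / 2 ≤ 1 / (2 * r) := by
    rw [le_div_iff₀ (by positivity)]
    have h1 : r * (a + 3 * t) ≤ 1 :=
      le_of_sq_le_sq_nonneg (a := 1) (c := r * (a + 3 * t)) zero_le_one (by rw [one_pow]; exact hpoly)
    linarith only [h1]
  -- conclude: `arccos (1/(2r)) ≤ arccos (cos θ) = θ`
  have h := Real.arccos_le_arccos (hcosθ.trans hx)
  rw [Real.arccos_cos hθ0 hθπ, hθdef] at h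
  linarith

/-- The polynomial behind the slope from below: with `a = √3`, `b = √6`, `0 ≤ τ ≤ 0.003`,
`κ = 1.5117`: `1 ≤ 4 (1/3 + (2b/3) τ − τ²)(a/2 − κ τ)²` (the difference is
`τ · ((2b − 2κ·(4a/3)·…) …)`, positive on the range). [folklore] -/
private theorem slope_lower_poly {a b τ : ℝ} (ha2 : a ^ 2 = 3) (halo : 1.732 ≤ a)
    (hahi : a ≤ 1.7321) (hblo : 2.449 ≤ b) (hbhi : b ≤ 2.4495) (hτ0 : 0 ≤ τ) (hτ1 : τ ≤ 0.003) :
    1 ≤ 4 * (1 / 3 + 2 * b / 3 * τ - τ ^ 2) * (a / 2 - 15117 / 10000 * τ) ^ 2 := by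
  have key : 4 * (1 / 3 + 2 * b / 3 * τ - τ ^ 2) * (a / 2 - 15117 / 10000 * τ) ^ 2 - 1 =
      (a ^ 2 / 3 - 1) + (-4 * a * (15117 / 10000) / 3 + 2 * b * a ^ 2 / 3) * τ
      + (4 * (15117 / 10000) ^ 2 / 3 - 8 * a * b * (15117 / 10000) / 3 - a ^ 2) * τ ^ 2
      + (8 * b * (15117 / 10000) ^ 2 / 3 + 4 * a * (15117 / 10000)) * τ ^ 3
      - 4 * (15117 / 10000) ^ 2 * τ ^ 4 := by
    ring
  have hc0 : a ^ 2 / 3 - 1 = 0 := by rw [ha2]; norm_num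
  rw [hc0, ha2] at key
  -- first-order coefficient ≥ 1.40, the rest is ≥ −18 τ − 10 τ³ on the range
  have h1 : 1.40 ≤ -4 * a * (15117 / 10000) / 3 + 2 * b * 3 / 3 := by nlinarith
  have h2 : -18 ≤ 4 * (15117 / 10000) ^ 2 / 3 - 8 * a * b * (15117 / 10000) / 3 - 3 := by
    nlinarith [mul_le_mul hahi hbhi (by linarith) (by linarith)]
  have h3 : 0 ≤ 8 * b * (15117 / 10000) ^ 2 / 3 + 4 * a * (15117 / 10000) := by positivity
  have hτ2 : τ ^ 2 ≤ 0.003 * τ := by nlinarith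
  have hτ4 : τ ^ 4 ≤ 0.003 ^ 3 * τ := by
    have : τ ^ 4 = τ ^ 2 * τ ^ 2 := by ring
    nlinarith [sq_nonneg τ, mul_le_mul hτ2 hτ2 (sq_nonneg τ) (by positivity)]
  have hB : 0 ≤ (-4 * a * (15117 / 10000) / 3 + 2 * b * 3 / 3) * τ
      + (4 * (15117 / 10000) ^ 2 / 3 - 8 * a * b * (15117 / 10000) / 3 - 3) * τ ^ 2
      + (8 * b * (15117 / 10000) ^ 2 / 3 + 4 * a * (15117 / 10000)) * τ ^ 3
      - 4 * (15117 / 10000) ^ 2 * τ ^ 4 := by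
    have e1 : 1.40 * τ ≤ (-4 * a * (15117 / 10000) / 3 + 2 * b * 3 / 3) * τ :=
      mul_le_mul_of_nonneg_right h1 hτ0
    have e2 : -18 * τ ^ 2 ≤ (4 * (15117 / 10000) ^ 2 / 3 - 8 * a * b * (15117 / 10000) / 3 - 3) * τ ^ 2 :=
      mul_le_mul_of_nonneg_right h2 (sq_nonneg τ)
    have e3 : 0 ≤ (8 * b * (15117 / 10000) ^ 2 / 3 + 4 * a * (15117 / 10000)) * τ ^ 3 :=
      mul_nonneg h3 (by positivity)
    nlinarith [e1, e2, e3, hτ2, hτ4]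
  linarith [key, hB]

/-- **Slope from below**: for `0.8138 ≤ w ≤ √6/3`, `π/6 − arccos (1/(2 √(1 − w²))) ≤ 3 (w − √6/3)`
(both sides `≤ 0`).  (`1/(2r) ≤ √3/2 − 1.5117 τ ≤ cos (π/6 + 3τ)`, `τ = √6/3 − w`, by
`slope_lower_poly`.) [cite: Kertesz1994, proof (range-narrowing, final step)] -/
theorem pi_div_six_sub_arccos_le_three_mul {w : ℝ} (hw0 : 0.8138 ≤ w) (hw1 : w ≤ √6 / 3) :
    π / 6 - arccos (1 / (2 * √(1 - w ^ 2))) ≤ 3 * (w - √6 / 3) := by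
  obtain ⟨hs6lo, hs6hi⟩ := sqrt_six_div_three_bounds
  have hw1' : w ≤ 0.8192 := by linarith
  obtain ⟨hr2lo, hr2hi⟩ := one_sub_sq_bounds hw0 hw1'
  set r := √(1 - w ^ 2) with hrdef
  have hr2 : r ^ 2 = 1 - w ^ 2 := by rw [hrdef, Real.sq_sqrt (by linarith)]
  have hr0 : 0 ≤ r := Real.sqrt_nonneg _
  have hrpos : 0 < r := by
    rcases hr0.eq_or_lt with h | h
    · rw [← h] at hr2; linarith
    · exact h
  set a := √3 with hadef
  set b := √6 with hbdef
  have ha2 : a ^ 2 = 3 := Real.sq_sqrt (by norm_num)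
  have hb2 : b ^ 2 = 6 := Real.sq_sqrt (by norm_num)
  have halo : 1.732 ≤ a := Real.le_sqrt_of_sq_le (by norm_num)
  have hahi : a ≤ 1.7321 := by
    rw [hadef, show (1.7321 : ℝ) = √(1.7321 ^ 2) from (Real.sqrt_sq (by norm_num)).symm]
    exact Real.sqrt_le_sqrt (by norm_num)
  have hblo : 2.449 ≤ b := by linarith
  have hbhi : b ≤ 2.4495 := by linarith
  set τ := b / 3 - w with hτdef
  have hτ0 : 0 ≤ τ := by rw [hτdef]; linarith
  have hτ1 : τ ≤ 0.003 := by rw [hτdef]; linarith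
  set θ := π / 6 + 3 * τ with hθdef
  have hθ0 : 0 ≤ θ := by rw [hθdef]; linarith [Real.pi_gt_three]
  have hθπ : θ ≤ π := by rw [hθdef]; linarith [Real.pi_gt_three]
  -- `R := a/2 − 1.5117 τ ≤ cos θ`
  set R := a / 2 - 15117 / 10000 * τ with hRdef
  have hcosθ : R ≤ cos θ := by
    rw [hθdef, Real.cos_add, Real.cos_pi_div_six, Real.sin_pi_div_six, ← hadef, hRdef]
    have h1 : 1 - (3 * τ) ^ 2 / 2 ≤ cos (3 * τ) := Real.one_sub_sq_div_two_le_cos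
    have h2 : sin (3 * τ) ≤ 3 * τ := Real.sin_le (by linarith)
    have h3 : a / 2 * (1 - (3 * τ) ^ 2 / 2) ≤ a / 2 * cos (3 * τ) :=
      mul_le_mul_of_nonneg_left h1 (by positivity)
    have h4 : a / 2 * ((3 * τ) ^ 2 / 2) ≤ 117 / 10000 * τ := by nlinarith
    nlinarith
  -- `1/(2r) ≤ R` from `1 ≤ (2 r R)²` and `2 r R ≥ 0`
  have hR0 : 0 ≤ R := by rw [hRdef]; nlinarith
  have hw : w = b / 3 - τ := by rw [hτdef]; ring
  have hr2' : r ^ 2 = 1 / 3 + 2 * b / 3 * τ - τ ^ 2 := by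
    rw [hr2, hw]; linear_combination (-1 / 9 : ℝ) * hb2
  have hpoly : 1 ≤ (2 * r * R) ^ 2 := by
    have : (2 * r * R) ^ 2 = 4 * r ^ 2 * R ^ 2 := by ring
    rw [this, hr2', hRdef]
    exact slope_lower_poly ha2 halo hahi hblo hbhi hτ0 hτ1
  have hx : 1 / (2 * r) ≤ R := by
    rw [div_le_iff₀ (by positivity)]
    have h1 : 0 ≤ 2 * r * R := by positivity
    have h2 : 1 ≤ 2 * r * R :=
      le_of_sq_le_sq_nonneg h1 (by rw [one_pow]; exact hpoly)
    linarith
  -- conclude: `θ = arccos (cos θ) ≤ arccos (1/(2r))`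
  have h := Real.arccos_le_arccos (hx.trans hcosθ)
  rw [Real.arccos_cos hθ0 hθπ, hθdef] at h
  linarith

/-! ### The bookkeeping -/

/-- `|y₁| + |y₂| + |y₃| ≤ Q` from the eight signed inequalities `±y₁ ± y₂ ± y₃ ≤ Q`. [folklore] -/
private theorem abs_add_abs_add_abs_le {y₁ y₂ y₃ Q : ℝ}
    (h1 : y₁ + y₂ + y₃ ≤ Q) (h2 : y₁ + y₂ - y₃ ≤ Q) (h3 : y₁ - y₂ + y₃ ≤ Q) (h4 : y₁ - y₂ - y₃ ≤ Q)
    (h5 : -y₁ + y₂ + y₃ ≤ Q) (h6 : -y₁ + y₂ - y₃ ≤ Q) (h7 : -y₁ - y₂ + y₃ ≤ Q)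
    (h8 : -y₁ - y₂ - y₃ ≤ Q) : |y₁| + |y₂| + |y₃| ≤ Q := by
  rcases abs_choice y₁ with e1 | e1 <;> rcases abs_choice y₂ with e2 | e2 <;>
    rcases abs_choice y₃ with e3 | e3 <;> rw [e1, e2, e3] <;> linarith

/-- `|x − y + z| ≤ |x| + |y| + |z|`. [folklore] -/
private theorem abs_sub_add_le (x y z : ℝ) : |x - y + z| ≤ |x| + |y| + |z| := by
  calc |x - y + z| ≤ |x - y| + |z| := abs_add_le _ _
    _ ≤ |x| + |y| + |z| := by linarith [abs_sub x y]

/-- **Local budget bookkeeping.**  Sector quantities `yₖ = uⱼ + uₖ'` for the sectors `12, 23, 31`,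
jump slacks `bₖ ≥ yₖ − 20 dₖ²` (`dₖ = tⱼ − tₖ'`), penalties `pₖ ≥ 0`, slope bounds `|uⱼ| ≥ 3 |tⱼ|`
in sign form and `|tⱼ| ≤ 3/1000`: the eight cover inequalities
`Σ_{k ∈ S} bₖ + Σ_{k ∉ S} (pₖ − yₖ) ≤ 0` force `t = 0` and `p = 0`.  (Choosing `S = {k : yₖ ≥ 0}`
gives `Σ |yₖ| ≤ 20 Σ dₖ² ≤ 80 Σ tⱼ² ≤ 0.24 Σ |tⱼ|`, while `Σ |yₖ| ≥ (2/3) Σ |uⱼ| ≥ 2 Σ |tⱼ|`.)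
[cite: Kertesz1994, proof (range-narrowing, final step)] -/
theorem local_budget_algebra {u₁ u₂ u₃ t₁ t₂ t₃ b₁₂ b₂₃ b₃₁ p₁₂ p₂₃ p₃₁ : ℝ}
    (hb₁₂ : u₁ + u₂ - 20 * (t₁ - t₂) ^ 2 ≤ b₁₂) (hb₂₃ : u₂ + u₃ - 20 * (t₂ - t₃) ^ 2 ≤ b₂₃)
    (hb₃₁ : u₃ + u₁ - 20 * (t₃ - t₁) ^ 2 ≤ b₃₁)
    (hu₁ : (0 ≤ t₁ → 3 * t₁ ≤ u₁) ∧ (t₁ ≤ 0 → u₁ ≤ 3 * t₁))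
    (hu₂ : (0 ≤ t₂ → 3 * t₂ ≤ u₂) ∧ (t₂ ≤ 0 → u₂ ≤ 3 * t₂))
    (hu₃ : (0 ≤ t₃ → 3 * t₃ ≤ u₃) ∧ (t₃ ≤ 0 → u₃ ≤ 3 * t₃))
    (ht₁ : |t₁| ≤ 3 / 1000) (ht₂ : |t₂| ≤ 3 / 1000) (ht₃ : |t₃| ≤ 3 / 1000)
    (hp₁₂ : 0 ≤ p₁₂) (hp₂₃ : 0 ≤ p₂₃) (hp₃₁ : 0 ≤ p₃₁)
    (hWWW : (p₁₂ - (u₁ + u₂)) + (p₂₃ - (u₂ + u₃)) + (p₃₁ - (u₃ + u₁)) ≤ 0)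
    (hJWW : b₁₂ + (p₂₃ - (u₂ + u₃)) + (p₃₁ - (u₃ + u₁)) ≤ 0)
    (hWJW : (p₁₂ - (u₁ + u₂)) + b₂₃ + (p₃₁ - (u₃ + u₁)) ≤ 0)
    (hWWJ : (p₁₂ - (u₁ + u₂)) + (p₂₃ - (u₂ + u₃)) + b₃₁ ≤ 0)
    (hJJW : b₁₂ + b₂₃ + (p₃₁ - (u₃ + u₁)) ≤ 0)
    (hJWJ : b₁₂ + (p₂₃ - (u₂ + u₃)) + b₃₁ ≤ 0)
    (hWJJ : (p₁₂ - (u₁ + u₂)) + b₂₃ + b₃₁ ≤ 0)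
    (hJJJ : b₁₂ + b₂₃ + b₃₁ ≤ 0) :
    t₁ = 0 ∧ t₂ = 0 ∧ t₃ = 0 ∧ p₁₂ = 0 ∧ p₂₃ = 0 ∧ p₃₁ = 0 := by
  have hq1 : 0 ≤ 20 * (t₁ - t₂) ^ 2 := by positivity
  have hq2 : 0 ≤ 20 * (t₂ - t₃) ^ 2 := by positivity
  have hq3 : 0 ≤ 20 * (t₃ - t₁) ^ 2 := by positivity
  -- the eight signed inequalities for `y = (u₁+u₂, u₂+u₃, u₃+u₁)` against `Q = Σ 20 dₖ²`
  have s1 : (u₁ + u₂) + (u₂ + u₃) + (u₃ + u₁) ≤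
      20 * (t₁ - t₂) ^ 2 + 20 * (t₂ - t₃) ^ 2 + 20 * (t₃ - t₁) ^ 2 := by
    linarith only [hJJJ, hb₁₂, hb₂₃, hb₃₁]
  have s2 : (u₁ + u₂) + (u₂ + u₃) - (u₃ + u₁) ≤
      20 * (t₁ - t₂) ^ 2 + 20 * (t₂ - t₃) ^ 2 + 20 * (t₃ - t₁) ^ 2 := by
    linarith only [hJJW, hb₁₂, hb₂₃, hp₃₁, hq3]
  have s3 : (u₁ + u₂) - (u₂ + u₃) + (u₃ + u₁) ≤
      20 * (t₁ - t₂) ^ 2 + 20 * (t₂ - t₃) ^ 2 + 20 * (t₃ - t₁) ^ 2 := by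
    linarith only [hJWJ, hb₁₂, hb₃₁, hp₂₃, hq2]
  have s4 : (u₁ + u₂) - (u₂ + u₃) - (u₃ + u₁) ≤
      20 * (t₁ - t₂) ^ 2 + 20 * (t₂ - t₃) ^ 2 + 20 * (t₃ - t₁) ^ 2 := by
    linarith only [hJWW, hb₁₂, hp₂₃, hp₃₁, hq2, hq3]
  have s5 : -(u₁ + u₂) + (u₂ + u₃) + (u₃ + u₁) ≤
      20 * (t₁ - t₂) ^ 2 + 20 * (t₂ - t₃) ^ 2 + 20 * (t₃ - t₁) ^ 2 := by
    linarith only [hWJJ, hb₂₃, hb₃₁, hp₁₂, hq1]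
  have s6 : -(u₁ + u₂) + (u₂ + u₃) - (u₃ + u₁) ≤
      20 * (t₁ - t₂) ^ 2 + 20 * (t₂ - t₃) ^ 2 + 20 * (t₃ - t₁) ^ 2 := by
    linarith only [hWJW, hb₂₃, hp₁₂, hp₃₁, hq1, hq3]
  have s7 : -(u₁ + u₂) - (u₂ + u₃) + (u₃ + u₁) ≤
      20 * (t₁ - t₂) ^ 2 + 20 * (t₂ - t₃) ^ 2 + 20 * (t₃ - t₁) ^ 2 := by
    linarith only [hWWJ, hb₃₁, hp₁₂, hp₂₃, hq1, hq2]
  have s8 : -(u₁ + u₂) - (u₂ + u₃) - (u₃ + u₁) ≤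
      20 * (t₁ - t₂) ^ 2 + 20 * (t₂ - t₃) ^ 2 + 20 * (t₃ - t₁) ^ 2 := by
    linarith only [hWWW, hp₁₂, hp₂₃, hp₃₁, hq1, hq2, hq3]
  have hsum := abs_add_abs_add_abs_le s1 s2 s3 s4 s5 s6 s7 s8
  -- `|uⱼ| ≤ Σ|y|/2`
  have hU1 : 2 * |u₁| ≤ |u₁ + u₂| + |u₂ + u₃| + |u₃ + u₁| := by
    have e : 2 * u₁ = (u₁ + u₂) - (u₂ + u₃) + (u₃ + u₁) := by ring
    have := abs_sub_add_le (u₁ + u₂) (u₂ + u₃) (u₃ + u₁)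
    rw [← e, abs_mul, abs_of_pos (by norm_num : (0:ℝ) < 2)] at this
    exact this
  have hU2 : 2 * |u₂| ≤ |u₁ + u₂| + |u₂ + u₃| + |u₃ + u₁| := by
    have e : 2 * u₂ = (u₂ + u₃) - (u₃ + u₁) + (u₁ + u₂) := by ring
    have := abs_sub_add_le (u₂ + u₃) (u₃ + u₁) (u₁ + u₂)
    rw [← e, abs_mul, abs_of_pos (by norm_num : (0:ℝ) < 2)] at this
    linarith
  have hU3 : 2 * |u₃| ≤ |u₁ + u₂| + |u₂ + u₃| + |u₃ + u₁| := by
    have e : 2 * u₃ = (u₃ + u₁) - (u₁ + u₂) + (u₂ + u₃) := by ring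
    have := abs_sub_add_le (u₃ + u₁) (u₁ + u₂) (u₂ + u₃)
    rw [← e, abs_mul, abs_of_pos (by norm_num : (0:ℝ) < 2)] at this
    linarith
  -- `3 |tⱼ| ≤ |uⱼ|`
  have hT : ∀ {u t : ℝ}, ((0 ≤ t → 3 * t ≤ u) ∧ (t ≤ 0 → u ≤ 3 * t)) → 3 * |t| ≤ |u| := by
    intro u t h
    rcases le_total 0 t with ht | ht
    · rw [abs_of_nonneg ht]; exact (h.1 ht).trans (le_abs_self u)
    · rw [abs_of_nonpos ht]
      have h1 := h.2 ht
      have h2 := neg_abs_le u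
      linarith
  have hT1 := hT hu₁
  have hT2 := hT hu₂
  have hT3 := hT hu₃
  -- `Q ≤ 0.24 (|t₁| + |t₂| + |t₃|)`
  have hsq : ∀ {t : ℝ}, |t| ≤ 3 / 1000 → t ^ 2 ≤ 3 / 1000 * |t| := by
    intro t ht
    have h1 : t ^ 2 = |t| * |t| := by rw [← sq_abs]; ring
    rw [h1]
    exact mul_le_mul_of_nonneg_right ht (abs_nonneg t)
  have h1 := hsq ht₁
  have h2 := hsq ht₂
  have h3 := hsq ht₃
  have e1 := sq_sub_le_two t₁ t₂
  have e2 := sq_sub_le_two t₂ t₃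
  have e3 := sq_sub_le_two t₃ t₁
  -- hence `Σ |tⱼ| = 0`
  have hzero : |t₁| + |t₂| + |t₃| ≤ 0 := by
    linarith only [hsum, hU1, hU2, hU3, hT1, hT2, hT3, h1, h2, h3, e1, e2, e3, abs_nonneg t₁,
      abs_nonneg t₂, abs_nonneg t₃]
  have ha1 : t₁ = 0 :=
    abs_eq_zero.1 (by linarith only [hzero, abs_nonneg t₁, abs_nonneg t₂, abs_nonneg t₃])
  have ha2 : t₂ = 0 :=
    abs_eq_zero.1 (by linarith only [hzero, abs_nonneg t₁, abs_nonneg t₂, abs_nonneg t₃])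
  have ha3 : t₃ = 0 :=
    abs_eq_zero.1 (by linarith only [hzero, abs_nonneg t₁, abs_nonneg t₂, abs_nonneg t₃])
  have hu1z : u₁ = 0 := by
    have h1 := hu₁.1 (ge_of_eq ha1); have h2 := hu₁.2 (le_of_eq ha1)
    rw [ha1] at h1 h2; linarith
  have hu2z : u₂ = 0 := by
    have h1 := hu₂.1 (ge_of_eq ha2); have h2 := hu₂.2 (le_of_eq ha2)
    rw [ha2] at h1 h2; linarith
  have hu3z : u₃ = 0 := by
    have h1 := hu₃.1 (ge_of_eq ha3); have h2 := hu₃.2 (le_of_eq ha3)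
    rw [ha3] at h1 h2; linarith
  rw [hu1z, hu2z, hu3z] at hWWW
  refine ⟨ha1, ha2, ha3, ?_, ?_, ?_⟩ <;> linarith only [hWWW, hp₁₂, hp₂₃, hp₃₁]

/-! ### Local rigidity -/

/-- **Kertész's configuration is budget-rigid.**  Let the three northern heights lie in the cube
`0.8138 ≤ wⱼ ≤ 0.8192` (around `w* = √6/3 = 0.8165`), let `Dⱼ = arccos (1/(2 √(1 − wⱼ²)))` and
`A_{jk} = arccos ((1/2 − wⱼ w_k)/(√(1 − wⱼ²) √(1 − w_k²)))` be the height-free azimuth bounds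
(`KerteszNorthernPoints.lean`), and let `p₁₂, p₂₃, p₃₁ ≥ 0` be sector penalties such that every one of
the eight jump/walk covers of the three sectors respects the azimuth budget:
`Σ_{k ∈ S} A_k + Σ_{k ∉ S} (Dⱼ + D_k + π/3 + p_k) ≤ 2π`.  Then `p₁₂ = p₂₃ = p₃₁ = 0` and
`w₁ = w₂ = w₃ = √6/3`.  (By `sector_lift_penalty` one may take `p = (z + z')/4` for the two low points
of a sector; so all six low points are equatorial.)  Proof: `arccos_highHigh_ge_local`, the two slope
bounds and `local_budget_algebra`. [cite: Kertesz1994, Theorem (uniqueness of the extremal arrangement)] -/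
theorem kertesz_local_rigidity {w₁ w₂ w₃ p₁₂ p₂₃ p₃₁ : ℝ}
    (h₁0 : 0.8138 ≤ w₁) (h₁1 : w₁ ≤ 0.8192) (h₂0 : 0.8138 ≤ w₂) (h₂1 : w₂ ≤ 0.8192)
    (h₃0 : 0.8138 ≤ w₃) (h₃1 : w₃ ≤ 0.8192)
    (hp₁₂ : 0 ≤ p₁₂) (hp₂₃ : 0 ≤ p₂₃) (hp₃₁ : 0 ≤ p₃₁)
    (hcover : ∀ j₁₂ j₂₃ j₃₁ : Bool,
      (if j₁₂ then arccos ((1 / 2 - w₁ * w₂) / (√(1 - w₁ ^ 2) * √(1 - w₂ ^ 2)))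
        else arccos (1 / (2 * √(1 - w₁ ^ 2))) + arccos (1 / (2 * √(1 - w₂ ^ 2))) + π / 3 + p₁₂) +
      (if j₂₃ then arccos ((1 / 2 - w₂ * w₃) / (√(1 - w₂ ^ 2) * √(1 - w₃ ^ 2)))
        else arccos (1 / (2 * √(1 - w₂ ^ 2))) + arccos (1 / (2 * √(1 - w₃ ^ 2))) + π / 3 + p₂₃) +
      (if j₃₁ then arccos ((1 / 2 - w₃ * w₁) / (√(1 - w₃ ^ 2) * √(1 - w₁ ^ 2)))
        else arccos (1 / (2 * √(1 - w₃ ^ 2))) + arccos (1 / (2 * √(1 - w₁ ^ 2))) + π / 3 + p₃₁)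
      ≤ 2 * π) :
    p₁₂ = 0 ∧ p₂₃ = 0 ∧ p₃₁ = 0 ∧ w₁ = √6 / 3 ∧ w₂ = √6 / 3 ∧ w₃ = √6 / 3 := by
  obtain ⟨hs6lo, hs6hi⟩ := sqrt_six_div_three_bounds
  -- (★) for the three pairs
  have hb₁₂ := arccos_highHigh_ge_local h₁0 h₁1 h₂0 h₂1
  have hb₂₃ := arccos_highHigh_ge_local h₂0 h₂1 h₃0 h₃1
  have hb₃₁ := arccos_highHigh_ge_local h₃0 h₃1 h₁0 h₁1
  -- slope bounds in sign form
  have hu : ∀ {w : ℝ}, 0.8138 ≤ w → w ≤ 0.8192 →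
      (0 ≤ w - √6 / 3 → 3 * (w - √6 / 3) ≤ π / 6 - arccos (1 / (2 * √(1 - w ^ 2)))) ∧
      (w - √6 / 3 ≤ 0 → π / 6 - arccos (1 / (2 * √(1 - w ^ 2))) ≤ 3 * (w - √6 / 3)) := by
    intro w hw0 hw1
    exact ⟨fun h => three_mul_le_pi_div_six_sub_arccos (by linarith) hw1,
      fun h => pi_div_six_sub_arccos_le_three_mul hw0 (by linarith)⟩
  have ht : ∀ {w : ℝ}, 0.8138 ≤ w → w ≤ 0.8192 → |w - √6 / 3| ≤ 3 / 1000 := by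
    intro w hw0 hw1
    rw [abs_le]; constructor <;> linarith
  -- the eight covers
  have c1 := hcover false false false
  have c2 := hcover true false false
  have c3 := hcover false true false
  have c4 := hcover false false true
  have c5 := hcover true true false
  have c6 := hcover true false true
  have c7 := hcover false true true
  have c8 := hcover true true true
  simp only [Bool.false_eq_true, ↓reduceIte] at c1 c2 c3 c4 c5 c6 c7 c8
  have e₁₂ : (w₁ - √6 / 3 - (w₂ - √6 / 3)) = w₁ - w₂ := by ring
  have e₂₃ : (w₂ - √6 / 3 - (w₃ - √6 / 3)) = w₂ - w₃ := by ring
  have e₃₁ : (w₃ - √6 / 3 - (w₁ - √6 / 3)) = w₃ - w₁ := by ring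
  have key := local_budget_algebra
    (u₁ := π / 6 - arccos (1 / (2 * √(1 - w₁ ^ 2))))
    (u₂ := π / 6 - arccos (1 / (2 * √(1 - w₂ ^ 2))))
    (u₃ := π / 6 - arccos (1 / (2 * √(1 - w₃ ^ 2))))
    (t₁ := w₁ - √6 / 3) (t₂ := w₂ - √6 / 3) (t₃ := w₃ - √6 / 3)
    (b₁₂ := arccos ((1 / 2 - w₁ * w₂) / (√(1 - w₁ ^ 2) * √(1 - w₂ ^ 2))) - 2 * π / 3)
    (b₂₃ := arccos ((1 / 2 - w₂ * w₃) / (√(1 - w₂ ^ 2) * √(1 - w₃ ^ 2))) - 2 * π / 3)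
    (b₃₁ := arccos ((1 / 2 - w₃ * w₁) / (√(1 - w₃ ^ 2) * √(1 - w₁ ^ 2))) - 2 * π / 3)
    (p₁₂ := p₁₂) (p₂₃ := p₂₃) (p₃₁ := p₃₁)
    (by rw [e₁₂]; linarith) (by rw [e₂₃]; linarith) (by rw [e₃₁]; linarith)
    (hu h₁0 h₁1) (hu h₂0 h₂1) (hu h₃0 h₃1) (ht h₁0 h₁1) (ht h₂0 h₂1) (ht h₃0 h₃1)
    hp₁₂ hp₂₃ hp₃₁
    (by linarith) (by linarith) (by linarith) (by linarith) (by linarith) (by linarith)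
    (by linarith) (by linarith)
  obtain ⟨e1, e2, e3, q1, q2, q3⟩ := key
  exact ⟨q1, q2, q3, by linarith, by linarith, by linarith⟩

end Literature.Geometry.DiscreteGeometry

end
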